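import Summits.ResolutionOfSingularities.ResolutionOfSingularities.Theorems.WildQuotientsSummitReductionStubPairOrbitBlowupCentreNewDrop
import HarnessLib

/-!
# `WildQuotients.SummitReduction` (stmt-ResolutionOfSingularities-16324), line `FramePerfect`, skeleton v8:
# stub `stub_pair_orbitBlowupCentreNew` (C3) — de Jong 1996, 3.4, Claim (iii) over the orbit centre:
# the new codimension-2 singular components (any field)

Route `ResolutionOfSingularities/WildQuotients`, crux `SummitReduction`; registered stub of the line
skeleton `Cruxes/SummitReduction/Lines/FramePerfect.lean` (v8, lead c4). Worker file.

De Jong 1996, 3.4, Claim (iii) (p. 64): "Let `T'` be an irreducible component of `Sing(X)`. There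
exists at most one such irreducible component `T̃ ⊂ Sing(X')` lying above `T'`; … `T' = T` in which
case we have `n_T̃ = n_T - 2`. … Chart "`t₁ ≠ 0`". — Here we get
`A[u, v, u', v']/(u - t₁u', v - t₁v', u'v' - t₁^{n₁-2} t₂^{n₂} ⋯ t_r^{n_r})`. Again the situation is
rather clear. The "new" component `T̃` lying over `T` is given by `u' = v' = t₁ = 0`, unless
`n₁ = 2, 3`, then `T̃` lying over `T` does not exist. Clearly, `n_T` has dropped by 2." — applied,
as in de Jong 1997, proof of Prop. 5.11 ¶1 ("we have to blow up in `T' = ∪_{σ ∈ G} σ(T)` …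
Since `D` is a `G`-strict normal crossings divisor … `T'` is a disjoint union of nonsingular `T`"),
to ANY blowing up `π : X₁ ⟶ X` of the curve `f : X ⟶ Y` of a quasi-split `G`-strict `G`-semi-stable
pair of the line in the reduced ideal of the orbit closure `Z = cl(G · x)` of a codimension-2
singular point `x`, over an ARBITRARY field (the tree's `DeJong1996SemiStableCodimTwoBlowupNewComponent_holds`
is the one-component statement over an algebraically closed field): (H5) every codimension-`≤ 2`
singular point `x₁` of `X₁` over `Z` lies over the orbit `G · x` itself, with `n(x₁) + 2 = n(x)`;
(H6) over `Z`, `π` is injective on such points — the hypotheses `hnew`, `huniq` of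
`stub_pair_orbitBlowupClaim_core_of_centre`.

Proof (`stub_pair_orbitBlowupCentreNew`), assembled from the worker files
`…CentreNew{Lemmas,Lemmas2,OrbitLemmas,Model,Transfer,Residue,Chart,BlowupModel,Thickness,Drop}.lean`:
for `x₁` over `z = π x₁ ∈ Z`, some translate `g x` specializes to `z`
(`centreNew_mem_closure_orbit_iff`); at `z` the quasi-split datum gives the formal model
`𝒪̂_{X,z} ≅ κ⟦u, v, T⟧/(uv - ∏ Tᵢ^{νᵢ})` (2.23 + 3.3 at a quasi-split point, any residue field), in
which the reduced ideal of `Z` completes to `(u, v, T_{i₀})` — the translates through `z` coincide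
by `G`-strictness (`centreNew_exists_orbitModel`); "completion and blowing up commute"
(`centreNew_transfer`) and the chart computation of p. 64 give `π x₁ = g x` and uniqueness; and
"Clearly, `n_T` has dropped by 2" (`centreNew_nodeThickness_drop`, through the rationality of the
new singular point, `centreNew_transfer_residue`) with `G`-invariance of `n`
(`centreNew_nodeThickness_translate`) gives `n(x₁) + 2 = n(g x) = n(x)`.
-/

set_option linter.dupNamespace false

noncomputable section

open CategoryTheory CategoryTheory.Limits AlgebraicGeometry TopologicalSpace
open Literature.AlgebraicGeometry.Resolution
open Literature.AlgebraicGeometry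

namespace Summit.ResolutionOfSingularities.ResolutionOfSingularities.Theorems

/-- **de Jong 1996, 3.4, Claim (iii) over the orbit centre — (H5) ∧ (H6), the new codimension-2
singular components** (stub C3 of line `FramePerfect`, v8), for the curve `f : X ⟶ Y` of a
quasi-split `G`-strict `G`-semi-stable pair of the line over an arbitrary field `k`, a
codimension-`≤ 2` singular point `x` and ANY blowing up `π : X₁ ⟶ X` in the reduced ideal of
`cl(G · x)`: a codimension-`≤ 2` singular point `x₁` of `X₁` over `cl(G · x)` lies over the orbit
`G · x` itself, with `n(x₁) + 2 = n(x)` ("The "new" component `T̃` lying over `T` is given by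
`u' = v' = t₁ = 0` … Clearly, `n_T̃` has dropped by 2"), and over `cl(G · x)` the map `π` is injective
on such points ("at most one such `T̃`"). See the module docstring for the proof.
[cite: DeJong1996, 3.4 Claim (iii), p. 64] [cite: DeJong1997, proof of Prop. 5.11, p. 618] -/
theorem stub_pair_orbitBlowupCentreNew (k : Type) [Field k] (Y : Scheme.{0}) [IsIntegral Y]
    (q : Y ⟶ Spec (.of k)) (_hprojY : Motives.IsProjectiveOver (Over.mk q))
    (hreg : Scheme.IsRegular Y) (D : Set Y)
    (hD : IsStrictNormalCrossingsDivisor Y D) (G : Type) [Group G] [Finite G] (ρY : G →* Aut Y)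
    (hDG : (∀ g : G, (ρY g).hom.base '' D = D))
    (hDstrict : (∀ (g : G) (C : Set Y), Maximal (fun C : Set Y => IsIrreducible C ∧ C ⊆ D) C →
        (C ∩ (ρY g).hom.base '' C).Nonempty → (ρY g).hom.base '' C = C))
    (X : Scheme.{0}) [IsIntegral X] (f : X ⟶ Y) (ρX : G →* Aut X)
    (hprojX : Motives.IsProjectiveOver (Over.mk (f ≫ q)))
    (hρf : ∀ g : G, (ρX g).hom ≫ f = f ≫ (ρY g).hom) (hss : IsSemiStableCurve f)
    (hqs : (∀ x : X, (¬ ∃ U : X.Opens, x ∈ U ∧ Smooth (U.ι ≫ f)) →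
        ∃ e : AdicCompletion
            ((IsLocalRing.maximalIdeal (X.presheaf.stalk x)).map (Ideal.Quotient.mk
              ((IsLocalRing.maximalIdeal (Y.presheaf.stalk (f.base x))).map (f.stalkMap x).hom)))
            (X.presheaf.stalk x ⧸
              (IsLocalRing.maximalIdeal (Y.presheaf.stalk (f.base x))).map (f.stalkMap x).hom) ≃+*
          MvPowerSeries (Fin 2) (Y.presheaf.stalk (f.base x) ⧸ IsLocalRing.maximalIdeal (Y.presheaf.stalk (f.base x))) ⧸
            Ideal.span {(MvPowerSeries.X 0 * MvPowerSeries.X 1 :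
              MvPowerSeries (Fin 2) (Y.presheaf.stalk (f.base x) ⧸ IsLocalRing.maximalIdeal (Y.presheaf.stalk (f.base x))))},
          e.toRingHom.comp ((algebraMap (X.presheaf.stalk x ⧸
              (IsLocalRing.maximalIdeal (Y.presheaf.stalk (f.base x))).map (f.stalkMap x).hom) _).comp
            (Ideal.quotientMap ((IsLocalRing.maximalIdeal (Y.presheaf.stalk (f.base x))).map (f.stalkMap x).hom)
              (f.stalkMap x).hom Ideal.le_comap_map)) =
          algebraMap (Y.presheaf.stalk (f.base x) ⧸ IsLocalRing.maximalIdeal (Y.presheaf.stalk (f.base x))) _))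
    (hsm : Smooth (f ∣_ ⟨Dᶜ, hD.isClosed.isOpen_compl⟩))
    (x : X) (hx : x ∈ Scheme.singularLocusCodimLE X 2) (X₁ : Scheme.{0}) (π : X₁ ⟶ X)
    (hπ : IsBlowup π (Scheme.IdealSheafData.vanishingIdeal
      ⟨closure (Set.range fun g : G => (ρX g).hom.base x), isClosed_closure⟩)) :
    (∀ x₁ ∈ Scheme.singularLocusCodimLE X₁ 2,
      π.base x₁ ∈ closure (Set.range fun g : G => (ρX g).hom.base x) →
        π.base x₁ ∈ Set.range (fun g : G => (ρX g).hom.base x) ∧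
          Scheme.Hom.nodeThickness (π ≫ f) x₁ + 2 = Scheme.Hom.nodeThickness f x) ∧
    (∀ x₁ ∈ Scheme.singularLocusCodimLE X₁ 2, ∀ x₁' ∈ Scheme.singularLocusCodimLE X₁ 2,
      π.base x₁ ∈ closure (Set.range fun g : G => (ρX g).hom.base x) →
        π.base x₁ = π.base x₁' → x₁ = x₁') := by
  classical
  haveI : IsNoetherian X := DeJong1996.isNoetherian_of_isProjectiveOver (f ≫ q) hprojX
  set Z : Set X := closure (Set.range fun g : G => (ρX g).hom.base x) with hZdef
  have hZ : IsClosed Z := isClosed_closure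
  -- the incidence clauses at a point over `Z`: it is a translate, and two such points coincide
  have key : ∀ x₁ ∈ Scheme.singularLocusCodimLE X₁ 2, π.base x₁ ∈ Z →
      ∃ g : G, π.base x₁ = (ρX g).hom.base x ∧
        ∀ x₁' ∈ Scheme.singularLocusCodimLE X₁ 2, π.base x₁' ∈ Z → π.base x₁' ⤳ π.base x₁ →
          x₁ = x₁' := by
    intro x₁ hx₁ hZ₁
    obtain ⟨g, hg⟩ := (centreNew_mem_closure_orbit_iff ρX x _).mp hZ₁
    obtain ⟨m, w, ν, i₀, ι, e₁, E, -, -, -, -, -, -, hi₀, -, -, hJ, hJ₀⟩ :=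
      centreNew_exists_orbitModel k Y q hreg D hD G ρY hDG hDstrict X f ρX hprojX hρf hss hqs hsm
        x hx hg
    obtain ⟨hover, huniq⟩ := centreNew_transfer hZ hπ hg hi₀ (e₁.trans E) hJ hJ₀
    exact ⟨g, (hover x₁ hx₁ hZ₁ le_rfl).1, fun x₁' hx₁' hZ₁' hsp' =>
      huniq x₁ hx₁ x₁' hx₁' hZ₁ hZ₁' le_rfl hsp'⟩
  refine ⟨fun x₁ hx₁ hZ₁ => ?_, fun x₁ hx₁ x₁' hx₁' hZ₁ heq => ?_⟩
  · obtain ⟨g, hg, -⟩ := key x₁ hx₁ hZ₁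
    refine ⟨⟨g, hg.symm⟩, ?_⟩
    exact (centreNew_nodeThickness_drop k Y q hreg D hD G ρY hDG hDstrict X f ρX hprojX hρf hss hqs
      hsm x hx X₁ π hπ x₁ hx₁ g hg).trans (centreNew_nodeThickness_translate f ρX ρY hρf g x)
  · obtain ⟨g, -, huniq⟩ := key x₁ hx₁ hZ₁
    have hZ₁' : π.base x₁' ∈ Z := heq ▸ hZ₁
    exact huniq x₁' hx₁' hZ₁' (heq ▸ le_rfl)

end Summit.ResolutionOfSingularities.ResolutionOfSingularities.Theorems

end
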